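import Summits.AtomisticToContinuum.Crystallization.Theses.PalmUnimodularRigidity
import Summits.AtomisticToContinuum.Crystallization.Theorems.MinimiserShells.Negative.LoadBearing
import Summits.AtomisticToContinuum.Crystallization.Theorems.MinimiserShells.Negative.Rootedness
import Summits.AtomisticToContinuum.Crystallization.Theorems.PalmUnimodularRigidityMinimiserShellsEquilibriumInLawWindowReal
import Literature.Probability.Process.PointStationaryLaw
import Literature.MathematicalPhysics.StatisticalMechanics.RootEnergy
import Literature.MathematicalPhysics.StatisticalMechanics.MuGSC

/-!
# The three observables and the pointwise cell inequality

Helper file for stub `stub_equilibriumInLaw` (S1) of line `equilibrium-in-law-surgery`, crux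
`MinimiserShells` (stmt-AtomisticToContinuum-9225): first half of blueprint lemma 11 (the
probabilistic assembly).

The three phase-periodic, jointly measurable observables fed to the cell-average identity:
* `F₁ δ μ u = ofReal (hTilde μ + Bshift δ)` — the (shifted, non-negative) root energy, read through
  the kernel (`hTilde μ = ½ ∫ V_LJ(‖z‖) d(lfKernel μ)`, `= ½ ∫ V_LJ(‖z‖) dμ` on hard-core `μ`);
* `F₂ δ L μ u = ofReal (tailBound δ ⌊depth L u⌋)` — the depth penalty of the root in its cell;
* `F₃ … μ u = 1[gainCount … μ ≠ 0] · 1[R₀ < depth L u]` — "the root is a deep gain site".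
On the counting measure of a rooted separated set the cell average of any `F` is the phase average
of `n_u⁻¹ ∑_{y ∈ S ∩ cell_u} F(θ_y, u − y)` (`cellAvg_count_restrict`), and the per-cell inequality
`cell_real_inequality` becomes the POINTWISE inequality
`ofReal(e* + Bshift) · vol(cube) + ofReal(c) · cellAvg F₃ ≤ cellAvg F₁ + cellAvg F₂`
(`pointwise_cell_inequality`).
-/

noncomputable section

open MeasureTheory ProbabilityTheory
open scoped ENNReal BigOperators

namespace Summit.AtomisticToContinuum.Crystallization.Theorems.PalmUnimodularRigidityMinimiserShells.EquilibriumInLaw.CellSums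

open Literature.Probability.Process (IsPointStationaryLaw IsRootedHardCore count_restrict_singleton_ne_zero_iff
  map_sub_count_restrict)
open Literature.MathematicalPhysics.StatisticalMechanics (lennardJones IsMuGSC UniformlyDiscrete)
open Summit.AtomisticToContinuum.Crystallization.Theses.PalmUnimodularRigidity (MinimiserShells UnimodularEnergyLowerBound)
open Summit.AtomisticToContinuum.Crystallization.Theorems.MinimiserShells.Negative.LoadBearing
  (eStar meanRootEnergy GoodShell minimiserShells_iff)
open Summit.AtomisticToContinuum.Crystallization.Theorems.MinimiserShells.Negative.Rootedness (E3
  countable_of_separated)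
open Summit.AtomisticToContinuum.Crystallization.Theorems.PalmUnimodularRigidityMinimiserShells.EquilibriumInLaw.Shells
  (tsum_abs_lennardJones_le_crude)
open Summit.AtomisticToContinuum.Crystallization.Theorems.PalmUnimodularRigidityMinimiserShells.EquilibriumInLaw.LfKernel
  (lfKernel lfKernel_count_restrict lintegral_count_restrict)
open Summit.AtomisticToContinuum.Crystallization.Theorems.PalmUnimodularRigidityMinimiserShells.EquilibriumInLaw.GainEvent
  (gainCount measurable_gainCount measurableSet_gainCount_ne_zero)
open Summit.AtomisticToContinuum.Crystallization.Theorems.PalmUnimodularRigidityMinimiserShells.EquilibriumInLaw.Phase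
  (cube cell depth measurableSet_cube measurableSet_cell zero_mem_cell finite_inter_cell measurable_depth)
open Summit.AtomisticToContinuum.Crystallization.Theorems.PalmUnimodularRigidityMinimiserShells.EquilibriumInLaw.Lattice
  (latticeL depth_add_of_mem_latticeL)
open Summit.AtomisticToContinuum.Crystallization.Theorems.PalmUnimodularRigidityMinimiserShells.EquilibriumInLaw.RootSums
  (Bδ Bδ_nonneg tailBound tailBound_nonneg integral_norm_count_restrict_image_sub measurable_lennardJones_norm)
open Summit.AtomisticToContinuum.Crystallization.Theorems.PalmUnimodularRigidityMinimiserShells.EquilibriumInLaw.CellAverage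
  (reroot reroot_eq_map measurable_reroot cellAvg measurable_cellAvgIntegrand)
open Summit.AtomisticToContinuum.Crystallization.Theorems.PalmUnimodularRigidityMinimiserShells.EquilibriumInLaw.WindowReal
  (cell_real_inequality)

/-! ## The measurable root energy -/

/-- The root energy read through the kernel: `½ ∫ V_LJ(‖z‖) d(lfKernel μ)`. -/
def hTilde (μ : Measure E3) : ℝ := (∫ z, lennardJones ‖z‖ ∂(lfKernel μ)) / 2

/-- `hTilde` is measurable. -/
theorem measurable_hTilde : Measurable hTilde := by
  have h := (measurable_lennardJones_norm.comp measurable_snd :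
    Measurable fun p : Measure E3 × E3 => lennardJones ‖p.2‖).stronglyMeasurable.integral_kernel_prod_right'
      (κ := lfKernel)
  exact h.measurable.div_const 2

/-- On measures fixed by the kernel `hTilde` is the honest root energy. -/
theorem hTilde_eq {μ : Measure E3} (hκ : lfKernel μ = μ) : hTilde μ = (∫ z, lennardJones ‖z‖ ∂μ) / 2 := by
  rw [hTilde, hκ]

/-- The shift making both the root energy and `e*` non-negative. -/
def Bshift (δ : ℝ) : ℝ := Bδ δ / 2 + |eStar|

/-- `e* + Bshift ≥ 0`. -/
theorem eStar_add_Bshift_nonneg (δ : ℝ) : 0 ≤ eStar + Bshift δ := by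
  unfold Bshift
  have := Bδ_nonneg δ
  have := neg_abs_le eStar
  linarith

/-! ## The three observables -/

/-- `F₁`: the shifted root energy (phase-independent). -/
def F₁ (δ : ℝ) (μ : Measure E3) (_u : E3) : ℝ≥0∞ := ENNReal.ofReal (hTilde μ + Bshift δ)

/-- `F₂`: the depth penalty of the root in its cell (configuration-independent). -/
def F₂ (δ L : ℝ) (_μ : Measure E3) (u : E3) : ℝ≥0∞ := ENNReal.ofReal (tailBound δ ⌊depth L u⌋₊)

/-- `F₃`: the root is a deep gain site. -/
def F₃ (L R₀ : ℝ) (n₀ k : ℕ) (r ε : ℝ) (R' : Fin k → E3) (μ : Measure E3) (u : E3) : ℝ≥0∞ :=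
  {μ : Measure E3 | gainCount n₀ k r ε R' μ ≠ 0}.indicator 1 μ * {u : E3 | R₀ < depth L u}.indicator 1 u

/-- `F₁` is jointly measurable. -/
theorem measurable_F₁ (δ : ℝ) : Measurable (Function.uncurry (F₁ δ)) :=
  ENNReal.measurable_ofReal.comp ((measurable_hTilde.comp measurable_fst).add_const _)

/-- `F₂` is jointly measurable. -/
theorem measurable_F₂ (δ L : ℝ) : Measurable (Function.uncurry (F₂ δ L)) := by
  have h : Measurable fun u : E3 => ⌊depth L u⌋₊ := Nat.measurable_floor.comp (measurable_depth L)
  have h' : Measurable fun u : E3 => tailBound δ ⌊depth L u⌋₊ := (measurable_of_countable (tailBound δ)).comp h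
  exact ENNReal.measurable_ofReal.comp (h'.comp measurable_snd)

/-- `F₃` is jointly measurable. -/
theorem measurable_F₃ (L R₀ : ℝ) (n₀ k : ℕ) (r ε : ℝ) (R' : Fin k → E3) :
    Measurable (Function.uncurry (F₃ L R₀ n₀ k r ε R')) :=
  ((measurable_one.indicator (measurableSet_gainCount_ne_zero n₀ k r ε R')).comp measurable_fst).mul
    ((measurable_one.indicator (measurableSet_lt measurable_const (measurable_depth L))).comp measurable_snd)

/-- `F₁` is phase-periodic (trivially). -/
theorem F₁_periodic (δ : ℝ) {L : ℝ} (hL : L ≠ 0) :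
    ∀ μ, ∀ v ∈ latticeL hL, ∀ u, F₁ δ μ (u + v) = F₁ δ μ u := fun _ _ _ _ => rfl

/-- `F₂` is phase-periodic. -/
theorem F₂_periodic (δ : ℝ) {L : ℝ} (hL : L ≠ 0) :
    ∀ μ, ∀ v ∈ latticeL hL, ∀ u, F₂ δ L μ (u + v) = F₂ δ L μ u := by
  intro μ v hv u
  simp only [F₂, depth_add_of_mem_latticeL hL hv]

/-- `F₃` is phase-periodic. -/
theorem F₃_periodic {L : ℝ} (hL : L ≠ 0) (R₀ : ℝ) (n₀ k : ℕ) (r ε : ℝ) (R' : Fin k → E3) :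
    ∀ μ, ∀ v ∈ latticeL hL, ∀ u, F₃ L R₀ n₀ k r ε R' μ (u + v) = F₃ L R₀ n₀ k r ε R' μ u := by
  intro μ v hv u
  simp only [F₃, Set.indicator_apply, Set.mem_setOf_eq, depth_add_of_mem_latticeL hL hv, Pi.one_apply]

/-! ## Cell averages on counting measures -/

/-- Integrating an indicator of the cell against `count|S` is summing over the finite window. -/
theorem lintegral_cell_indicator {L δ : ℝ} (hL : 0 < L) (hδ : 0 < δ) {S : Set E3}
    (hsep : ∀ x ∈ S, ∀ y ∈ S, x ≠ y → δ ≤ dist x y) (u : E3) (g : E3 → ℝ≥0∞) :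
    ∫⁻ y, (cell L u).indicator g y ∂(Measure.count : Measure E3).restrict S =
      ∑ y ∈ (finite_inter_cell hL hδ hsep u).toFinset, g y := by
  rw [lintegral_count_restrict (countable_of_separated hδ hsep), tsum_subtype S ((cell L u).indicator g),
    Set.indicator_indicator, ← Finset.tsum_subtype', tsum_subtype]
  congr 1
  funext x
  rw [(finite_inter_cell hL hδ hsep u).coe_toFinset]

/-- The cell mass of `count|S` is the size of the finite window. -/
theorem count_restrict_cell {L δ : ℝ} (hL : 0 < L) (hδ : 0 < δ) {S : Set E3}
    (hsep : ∀ x ∈ S, ∀ y ∈ S, x ≠ y → δ ≤ dist x y) (u : E3) :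
    (Measure.count : Measure E3).restrict S (cell L u) = ((finite_inter_cell hL hδ hsep u).toFinset.card : ℝ≥0∞) := by
  rw [Measure.restrict_apply (measurableSet_cell L u), Set.inter_comm,
    Measure.count_apply_finite _ (finite_inter_cell hL hδ hsep u)]

/-- **The cell average on a counting measure**: the phase average of
`n_u⁻¹ ∑_{y ∈ S ∩ cell_u} F (reroot (count|S, y)) (u − y)`. -/
theorem cellAvg_count_restrict {L δ : ℝ} (hL : 0 < L) (hδ : 0 < δ) {S : Set E3}
    (hsep : ∀ x ∈ S, ∀ y ∈ S, x ≠ y → δ ≤ dist x y) (F : Measure E3 → E3 → ℝ≥0∞) :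
    cellAvg L F ((Measure.count : Measure E3).restrict S) =
      ∫⁻ u in cube L, (((finite_inter_cell hL hδ hsep u).toFinset.card : ℝ≥0∞))⁻¹ *
        ∑ y ∈ (finite_inter_cell hL hδ hsep u).toFinset,
          F (reroot ((Measure.count : Measure E3).restrict S, y)) (u - y) := by
  unfold cellAvg
  rw [lfKernel_count_restrict hδ hsep]
  refine lintegral_congr fun u => ?_
  rw [count_restrict_cell hL hδ hsep u, lintegral_cell_indicator hL hδ hsep u]

/-- Re-rooting a counting measure at `y`. -/
theorem reroot_count_restrict {δ : ℝ} (hδ : 0 < δ) {S : Set E3}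
    (hsep : ∀ x ∈ S, ∀ y ∈ S, x ≠ y → δ ≤ dist x y) (y : E3) :
    reroot ((Measure.count : Measure E3).restrict S, y) =
      (Measure.count : Measure E3).restrict ((fun z => z - y) '' S) := by
  rw [reroot_eq_map (lfKernel_count_restrict hδ hsep) y, map_sub_count_restrict]

/-- The re-rooted set is again separated. -/
theorem sep_image_sub {δ : ℝ} {S : Set E3} (hsep : ∀ x ∈ S, ∀ y ∈ S, x ≠ y → δ ≤ dist x y) (y : E3) :
    ∀ x ∈ (fun z => z - y) '' S, ∀ x' ∈ (fun z => z - y) '' S, x ≠ x' → δ ≤ dist x x' := by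
  rintro _ ⟨a, ha, rfl⟩ _ ⟨b, hb, rfl⟩ hne
  rw [dist_sub_right]
  exact hsep a ha b hb fun h => hne (by rw [h])

/-- **`F₁` at a re-rooted atom** is the shifted lattice sum `ofReal (½ ∑_{z ∈ S} V(|y − z|) + Bshift)`. -/
theorem F₁_reroot {δ : ℝ} (hδ : 0 < δ) {S : Set E3}
    (hsep : ∀ x ∈ S, ∀ y ∈ S, x ≠ y → δ ≤ dist x y) (y w : E3) :
    F₁ δ (reroot ((Measure.count : Measure E3).restrict S, y)) w =
      ENNReal.ofReal ((∑' z : S, lennardJones (dist y z)) / 2 + Bshift δ) := by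
  rw [F₁, reroot_count_restrict hδ hsep, hTilde_eq (lfKernel_count_restrict hδ (sep_image_sub hsep y)),
    integral_norm_count_restrict_image_sub hδ hsep y]

/-- The lattice sum seen from an atom is bounded: `|∑_{z ∈ S} V(|y − z|)| ≤ Bδ`. -/
theorem abs_tsum_le_Bδ {δ : ℝ} (hδ : 0 < δ) {S : Set E3}
    (hsep : ∀ x ∈ S, ∀ y ∈ S, x ≠ y → δ ≤ dist x y) {y : E3} (hy : y ∈ S) :
    |∑' z : S, lennardJones (dist y z)| ≤ Bδ δ := by
  have h := (tsum_abs_lennardJones_le_crude (T := S) y hδ (fun z hz hzy => hsep y hy z hz (Ne.symm hzy)) hsep).2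
  unfold Bδ
  exact h

/-! ## The pointwise cell inequality -/

/-- **The pointwise cell inequality.** For every hard core `δ` and modification type there are
`R₀, c > 0` (those of `cell_real_inequality`) such that for every `L > 0` and every rooted
`δ`-hard-core configuration `μ`:
`ofReal(e* + Bshift) · vol(cube L) + ofReal(c) · cellAvg L F₃ μ ≤ cellAvg L F₁ μ + cellAvg L F₂ μ`. -/
theorem pointwise_cell_inequality {δ : ℝ} (hδ : 0 < δ) (n₀ k : ℕ) {r ε : ℝ} (hr : 0 ≤ r) (hε : 0 < ε)
    (R' : Fin k → E3) :
    ∃ R₀ c : ℝ, 0 < R₀ ∧ 0 < c ∧ ∀ {L : ℝ}, 0 < L → ∀ {μ : Measure E3}, IsRootedHardCore δ μ →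
      ENNReal.ofReal (eStar + Bshift δ) * volume (cube L) +
          ENNReal.ofReal c * cellAvg L (F₃ L R₀ n₀ k r ε R') μ ≤
        cellAvg L (F₁ δ) μ + cellAvg L (F₂ δ L) μ := by
  obtain ⟨R₀, c, hR₀, hc, hcell⟩ := cell_real_inequality hδ n₀ k hr hε R'
  refine ⟨R₀, c, hR₀, hc, ?_⟩
  intro L hL μ hμ
  obtain ⟨S, h0, hsep, rfl⟩ := hμ
  have hκ := lfKernel_count_restrict hδ hsep
  -- notation for the windows
  set C : E3 → Finset E3 := fun u => (finite_inter_cell hL hδ hsep u).toFinset with hC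
  have hCcoe : ∀ u, (↑(C u) : Set E3) = S ∩ cell L u := fun u => (finite_inter_cell hL hδ hsep u).coe_toFinset
  have hCne : ∀ u, ((C u).card : ℝ≥0∞) ≠ 0 := by
    intro u h
    have h0C : (0 : E3) ∈ C u := by
      rw [← Finset.mem_coe, hCcoe]; exact ⟨h0, zero_mem_cell L u⟩
    rw [Nat.cast_eq_zero, Finset.card_eq_zero] at h
    rw [h] at h0C
    exact absurd h0C (Finset.notMem_empty _)
  have hCtop : ∀ u, ((C u).card : ℝ≥0∞) ≠ ∞ := fun u => ENNReal.natCast_ne_top _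
  -- the three integrands
  rw [cellAvg_count_restrict hL hδ hsep (F₁ δ), cellAvg_count_restrict hL hδ hsep (F₂ δ L),
    cellAvg_count_restrict hL hδ hsep (F₃ L R₀ n₀ k r ε R')]
  -- measurability of the integrands in the phase
  have hmeas : ∀ {F : Measure E3 → E3 → ℝ≥0∞}, Measurable (Function.uncurry F) →
      Measurable fun u : E3 => (((C u).card : ℝ≥0∞))⁻¹ *
        ∑ y ∈ C u, F (reroot ((Measure.count : Measure E3).restrict S, y)) (u - y) := by
    intro F hF
    have h := (measurable_cellAvgIntegrand (L := L) hF).comp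
      (measurable_const.prodMk measurable_id :
        Measurable fun u : E3 => ((Measure.count : Measure E3).restrict S, u))
    have heq : (fun u : E3 => (((C u).card : ℝ≥0∞))⁻¹ *
        ∑ y ∈ C u, F (reroot ((Measure.count : Measure E3).restrict S, y)) (u - y)) =
        (fun a : Measure E3 × E3 => (lfKernel a.1 (cell L a.2))⁻¹ *
          ∫⁻ y, (cell L a.2).indicator (fun y => F (reroot (a.1, y)) (a.2 - y)) y ∂(lfKernel a.1)) ∘
          fun u : E3 => ((Measure.count : Measure E3).restrict S, u) := by
      funext u
      simp only [Function.comp_apply, hκ, count_restrict_cell hL hδ hsep u, lintegral_cell_indicator hL hδ hsep u,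
        hC]
    rw [heq]
    exact h
  -- pointwise in the phase
  have hpw : ∀ u, ENNReal.ofReal (eStar + Bshift δ) + ENNReal.ofReal c *
      ((((C u).card : ℝ≥0∞))⁻¹ * ∑ y ∈ C u,
        F₃ L R₀ n₀ k r ε R' (reroot ((Measure.count : Measure E3).restrict S, y)) (u - y)) ≤
      (((C u).card : ℝ≥0∞))⁻¹ * ∑ y ∈ C u, F₁ δ (reroot ((Measure.count : Measure E3).restrict S, y)) (u - y) +
      (((C u).card : ℝ≥0∞))⁻¹ * ∑ y ∈ C u, F₂ δ L (reroot ((Measure.count : Measure E3).restrict S, y)) (u - y) := by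
    intro u
    -- the real inequality of the cell
    have hreal := hcell hL hsep u (C u) (hCcoe u)
    set G := (C u).filter (fun y => R₀ < depth L (u - y) ∧
      gainCount n₀ k r ε R' (reroot ((Measure.count : Measure E3).restrict S, y)) ≠ 0) with hG
    -- rewrite the three sums
    have hS1 : ∑ y ∈ C u, F₁ δ (reroot ((Measure.count : Measure E3).restrict S, y)) (u - y) =
        ∑ y ∈ C u, ENNReal.ofReal ((∑' z : S, lennardJones (dist y z)) / 2 + Bshift δ) :=
      Finset.sum_congr rfl fun y _ => F₁_reroot hδ hsep y _
    have hS2 : ∑ y ∈ C u, F₂ δ L (reroot ((Measure.count : Measure E3).restrict S, y)) (u - y) =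
        ∑ y ∈ C u, ENNReal.ofReal (tailBound δ ⌊depth L (u - y)⌋₊) := rfl
    have hS3 : ∑ y ∈ C u, F₃ L R₀ n₀ k r ε R' (reroot ((Measure.count : Measure E3).restrict S, y)) (u - y) =
        (G.card : ℝ≥0∞) := by
      rw [hG, Finset.natCast_card_filter]
      refine Finset.sum_congr rfl fun y _ => ?_
      simp only [F₃, Set.indicator_apply, Set.mem_setOf_eq, Pi.one_apply, mul_ite, mul_one, mul_zero]
      by_cases h1 : gainCount n₀ k r ε R' (reroot ((Measure.count : Measure E3).restrict S, y)) ≠ 0 <;>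
        by_cases h2 : R₀ < depth L (u - y) <;> simp [h1, h2]
    rw [hS1, hS2, hS3]
    -- non-negativity of the summands
    have hpos1 : ∀ y ∈ C u, 0 ≤ (∑' z : S, lennardJones (dist y z)) / 2 + Bshift δ := by
      intro y hy
      have hyS : y ∈ S := ((hCcoe u) ▸ (Finset.mem_coe.2 hy) : y ∈ S ∩ cell L u).1
      have hb := abs_tsum_le_Bδ hδ hsep hyS
      rw [abs_le] at hb
      unfold Bshift
      have ha := abs_nonneg eStar
      linarith [hb.1]
    -- the real inequality, shifted
    have hreal' : ((C u).card : ℝ) * (eStar + Bshift δ) + c * G.card ≤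
        ∑ y ∈ C u, (((∑' z : S, lennardJones (dist y z)) / 2 + Bshift δ) + tailBound δ ⌊depth L (u - y)⌋₊) := by
      have h1 : ∑ y ∈ C u, (((∑' z : S, lennardJones (dist y z)) / 2 + Bshift δ) +
          tailBound δ ⌊depth L (u - y)⌋₊) =
          ∑ y ∈ C u, ((∑' z : S, lennardJones (dist y z)) / 2 + tailBound δ ⌊depth L (u - y)⌋₊) +
            (C u).card * Bshift δ := by
        rw [Finset.sum_add_distrib, Finset.sum_add_distrib, Finset.sum_add_distrib, Finset.sum_const,
          nsmul_eq_mul]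
        ring
      have h2 : ∑ y ∈ C u, ((∑' z : S, lennardJones (dist y z)) / 2 + tailBound δ ⌊depth L (u - y)⌋₊ / 2) ≤
          ∑ y ∈ C u, ((∑' z : S, lennardJones (dist y z)) / 2 + tailBound δ ⌊depth L (u - y)⌋₊) :=
        Finset.sum_le_sum fun y _ => by linarith [tailBound_nonneg δ ⌊depth L (u - y)⌋₊]
      rw [h1]
      linarith
    -- pass to `ℝ≥0∞`
    have hofReal := ENNReal.ofReal_le_ofReal hreal'
    rw [ENNReal.ofReal_add (mul_nonneg (Nat.cast_nonneg _) (eStar_add_Bshift_nonneg δ))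
        (mul_nonneg hc.le (Nat.cast_nonneg _)), ENNReal.ofReal_mul (Nat.cast_nonneg _), ENNReal.ofReal_natCast,
      ENNReal.ofReal_mul hc.le, ENNReal.ofReal_natCast,
      ENNReal.ofReal_sum_of_nonneg (fun y hy => add_nonneg (hpos1 y hy) (tailBound_nonneg δ _))] at hofReal
    have hsplit : ∑ y ∈ C u, ENNReal.ofReal (((∑' z : S, lennardJones (dist y z)) / 2 + Bshift δ) +
        tailBound δ ⌊depth L (u - y)⌋₊) =
        ∑ y ∈ C u, ENNReal.ofReal ((∑' z : S, lennardJones (dist y z)) / 2 + Bshift δ) +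
          ∑ y ∈ C u, ENNReal.ofReal (tailBound δ ⌊depth L (u - y)⌋₊) := by
      rw [← Finset.sum_add_distrib]
      exact Finset.sum_congr rfl fun y hy => ENNReal.ofReal_add (hpos1 y hy) (tailBound_nonneg δ _)
    rw [hsplit] at hofReal
    -- divide by the window size
    have hinv := mul_le_mul' (le_refl ((((C u).card : ℝ≥0∞))⁻¹)) hofReal
    rw [mul_add, mul_add, ← mul_assoc, ENNReal.inv_mul_cancel (hCne u) (hCtop u), one_mul, ← mul_assoc,
      mul_comm ((((C u).card : ℝ≥0∞))⁻¹) (ENNReal.ofReal c), mul_assoc] at hinv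
    have := eStar_add_Bshift_nonneg δ
    exact hinv
  -- integrate over the phase cube
  have hI3 := hmeas (measurable_F₃ L R₀ n₀ k r ε R')
  have hI1 := hmeas (measurable_F₁ δ)
  calc ENNReal.ofReal (eStar + Bshift δ) * volume (cube L) + ENNReal.ofReal c *
        ∫⁻ u in cube L, (((C u).card : ℝ≥0∞))⁻¹ *
          ∑ y ∈ C u, F₃ L R₀ n₀ k r ε R' (reroot ((Measure.count : Measure E3).restrict S, y)) (u - y)
      = ∫⁻ u in cube L, (ENNReal.ofReal (eStar + Bshift δ) + ENNReal.ofReal c *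
          ((((C u).card : ℝ≥0∞))⁻¹ * ∑ y ∈ C u,
            F₃ L R₀ n₀ k r ε R' (reroot ((Measure.count : Measure E3).restrict S, y)) (u - y))) := by
        rw [lintegral_add_left measurable_const, setLIntegral_const, lintegral_const_mul _ hI3]
    _ ≤ ∫⁻ u in cube L, ((((C u).card : ℝ≥0∞))⁻¹ *
          ∑ y ∈ C u, F₁ δ (reroot ((Measure.count : Measure E3).restrict S, y)) (u - y) +
        (((C u).card : ℝ≥0∞))⁻¹ *
          ∑ y ∈ C u, F₂ δ L (reroot ((Measure.count : Measure E3).restrict S, y)) (u - y)) :=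
        lintegral_mono fun u => hpw u
    _ = _ := lintegral_add_left hI1 _

/-- Registered stub marker (helper part 13/14 of `stub_equilibriumInLaw`, line `equilibrium-in-law-surgery`):
the pointwise cell inequality `pointwise_cell_inequality`, closed form. -/
theorem stub_equilibriumInLaw_part13 :
    ∀ (δ : ℝ), 0 < δ → ∀ (n₀ k : ℕ) (r ε : ℝ), 0 ≤ r → 0 < ε → ∀ (R' : Fin k → EuclideanSpace ℝ (Fin 3)),
    ∃ R₀ c : ℝ, 0 < R₀ ∧ 0 < c ∧ ∀ {L : ℝ}, 0 < L → ∀ {μ : Measure (EuclideanSpace ℝ (Fin 3))}, IsRootedHardCore δ μ →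
      ENNReal.ofReal (eStar + Bshift δ) * volume (cube L) +
          ENNReal.ofReal c * cellAvg L (F₃ L R₀ n₀ k r ε R') μ ≤
        cellAvg L (F₁ δ) μ + cellAvg L (F₂ δ L) μ :=
  fun _ hδ n₀ k _ _ hr hε R' => pointwise_cell_inequality hδ n₀ k hr hε R'

end Summit.AtomisticToContinuum.Crystallization.Theorems.PalmUnimodularRigidityMinimiserShells.EquilibriumInLaw.CellSums

end
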